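import Literature.NumberTheory.EllipticCurves.CMTorsionGaloisImageHoldsProofs
import Literature.NumberTheory.EllipticCurves.GaloisActionProofs
import Literature.NumberTheory.GaloisRepresentations.AbsGaloisGroup
import Summits.ABC.ABC.Theorems.IsogenyGlueCongruenceEllipticGluingPrimeBoundStubImageDichotomyCore
import Summits.ABC.ABC.Theorems.IsogenyGlueCongruenceEllipticGluingPrimeBoundStubAbelianNormalCentral
import HarnessLib

/-!
# Crux `EllipticGluingPrimeBound`, line SketchIdeator5 — stub `stub_noCMPartnerOfSurjective`
# (a surjective-image curve shares no `ℓ`-torsion with a CM curve)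

Stub `stub_noCMPartnerOfSurjective` of line `SketchIdeator5` of crux U
`Summit.ABC.ABC.Theses.IsogenyGlueCongruence.EllipticGluingPrimeBound` (item stmt-ABC-13919),
registered signature (namespace `Summit.ABC.ABC.Theorems.GluingSlices`). It is the `d = 1`
CERTIFICATE that CM partners never occur in the generic residual R_gen of the line: beyond a
threshold `L₀`, an elliptic curve `W/ℚ` whose mod-`ℓ` Galois representation is SURJECTIVE admits no
`Γ_ℚ`-equivariant injection `W[ℓ] ↪ W'(ℚ̄)` into a CM curve `W'/ℚ`.

**Proof.** The uniform CM torsion theorem (`cmTorsion_cartanImage_holds`, Lang, *Elliptic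
Functions*, Ch. 10 §4) gives, for every CM curve `W'/ℚ` and prime `ℓ > L₀`, a NON-scalar
endomorphism `φ` of `W'[ℓ]` and a quadratic character `χ : Γ_ℚ → {±1}` with
`φ(σP) = χ(σ)·σφ(P)`. An equivariant injection `ι : W[ℓ] ↪ W'(ℚ̄)` lands in `W'[ℓ]`
(`ℓ ι P = ι (ℓ P) = 0`) and `#W[ℓ] = ℓ² = #W'[ℓ]` (`card_torsionPoints_eq_sq_holds`), so `ι` is an
equivariant isomorphism `e : W[ℓ] ≃ W'[ℓ]`; the transport `ψ = e⁻¹ φ e` is a non-scalar additive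
endomorphism of `W[ℓ]` with `ψ(τ v) = χ(τ) · τ ψ(v)`, and `χ(σσ) = χ(σ)² = 1`. Surjectivity of
`ρ̄_{W,ℓ} : Γ_ℚ → Aut(W[ℓ])` writes EVERY additive automorphism `g` of `W[ℓ]` as `ρ̄(σ)`, so `ψ`
commutes with every square `g² = ρ̄(σσ)`. Linear algebra (`exists_eq_zsmul_of_comm_sq`): in a basis
of the plane `W[ℓ] ≅ 𝔽_ℓ²` (`ℓ` odd) the elementary unipotents `(1 1; 0 1) = (1 h; 0 1)²`,
`(1 0; 1 1) = (1 0; h 1)²` (`2h = 1`) are squares, so the matrix of `ψ` commutes with both and is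
scalar (`fin_two_scalar_of_commute_unipotent_conj`) — contradicting non-scalarity of `φ`.
Threshold: `max L₀ 2`. No named facts beyond the PROVED `cmTorsion_cartanImage_holds`; no
definitions; no `sorry`.
-/

noncomputable section

-- `Summit.<Summit>.<Problem>` is the mandated summit-side namespace (CONVENTIONS §2); for the
-- single-conjunct summit `ABC` the two coincide, so the duplicate `ABC.ABC` is deliberate.
set_option linter.dupNamespace false

namespace Summit.ABC.ABC.Theorems.GluingSlices

/-- **Linear-algebra core.** On an abelian group `V` of order `ℓ²` killed by the odd prime `ℓ`
(a plane over `𝔽_ℓ`), an additive endomorphism `ψ` commuting with the square `g ∘ g` of every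
additive automorphism `g` of `V` is an integer scalar: the elementary unipotent matrices
`(1 1; 0 1) = (1 h; 0 1)²` and `(1 0; 1 1) = (1 0; h 1)²` with `2h = 1` are squares, and a matrix
commuting with both is scalar (`fin_two_scalar_of_commute_unipotent_conj`). -/
theorem exists_eq_zsmul_of_comm_sq {ℓ : ℕ} [Fact ℓ.Prime] (h3 : 3 ≤ ℓ) {V : Type*}
    [AddCommGroup V] (hcard : Nat.card V = ℓ ^ 2) (htor : ∀ v : V, ℓ • v = 0) (ψ : V →+ V)
    (hψ : ∀ (g : V ≃+ V) (v : V), ψ (g (g v)) = g (g (ψ v))) :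
    ∃ c : ℤ, ∀ v : V, ψ v = c • v := by
  classical
  have hprime : ℓ.Prime := Fact.out
  haveI : Module (ZMod ℓ) V := AddCommGroup.zmodModule htor
  haveI : Finite V :=
    Nat.finite_of_card_ne_zero (by rw [hcard]; exact pow_ne_zero _ hprime.ne_zero)
  haveI : Module.Finite (ZMod ℓ) V := Module.Finite.of_finite
  have hrank : Module.finrank (ZMod ℓ) V = 2 := by
    have h := Module.natCard_eq_pow_finrank (K := ZMod ℓ) (V := V)
    rw [hcard, Nat.card_zmod] at h
    exact (Nat.pow_right_injective hprime.two_le h).symm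
  let bV := Module.finBasisOfFinrankEq (ZMod ℓ) V hrank
  -- `2` is invertible in `ℤ/ℓ`: pick `h` with `h + h = 1`
  have h2 : (2 : ZMod ℓ) ≠ 0 := by
    intro h
    have hdvd : ℓ ∣ 2 := (ZMod.natCast_eq_zero_iff 2 ℓ).mp (by exact_mod_cast h)
    have := Nat.le_of_dvd (by norm_num) hdvd
    omega
  obtain ⟨h, h2h⟩ : ∃ h : ZMod ℓ, h + h = 1 := ⟨2⁻¹, by rw [← two_mul, mul_inv_cancel₀ h2]⟩
  -- matrices ↔ linear endomorphisms in the basis `bV`; `x` is the matrix of `ψ`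
  set T := Matrix.toLinAlgEquiv bV
  obtain ⟨x, hx⟩ : ∃ x : Matrix (Fin 2) (Fin 2) (ZMod ℓ), T x = ψ.toZModLinearMap ℓ :=
    ⟨_, T.apply_symm_apply _⟩
  have hxψ : ∀ v, T x v = ψ v := fun v ↦ by rw [hx]; rfl
  -- `x` commutes with `S * S` for every invertible matrix `S`
  have key : ∀ S S' : Matrix (Fin 2) (Fin 2) (ZMod ℓ), S * S' = 1 → S' * S = 1 →
      x * (S * S) = S * S * x := by
    intro S S' h1 h1'
    let g : V ≃ₗ[ZMod ℓ] V :=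
      LinearEquiv.ofLinear (T S) (T S')
        (by rw [← Module.End.mul_eq_comp, ← map_mul T, h1, map_one T, Module.End.one_eq_id])
        (by rw [← Module.End.mul_eq_comp, ← map_mul T, h1', map_one T, Module.End.one_eq_id])
    have hg : ∀ w, g.toAddEquiv w = T S w := fun w ↦ rfl
    have hgψ := hψ g.toAddEquiv
    simp only [hg] at hgψ
    apply T.injective
    simp only [map_mul]
    refine LinearMap.ext fun v ↦ ?_
    simp only [Module.End.mul_apply, hxψ]
    exact hgψ v
  -- the two elementary unipotents are squares, hence commute with `x`
  have hu := key !![1, h; 0, 1] !![1, -h; 0, 1] (by simp [Matrix.one_fin_two])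
    (by simp [Matrix.one_fin_two])
  have hw := key !![1, 0; h, 1] !![1, 0; -h, 1] (by simp [Matrix.one_fin_two])
    (by simp [Matrix.one_fin_two])
  have hSu : !![1, h; 0, 1] * !![1, h; 0, 1] = !![(1 : ZMod ℓ), 1; 0, 1] := by
    rw [Matrix.mul_fin_two]; simp [h2h]
  have hSw : !![1, 0; h, 1] * !![1, 0; h, 1] = !![(1 : ZMod ℓ), 0; 1, 1] := by
    rw [Matrix.mul_fin_two]; simp [h2h]
  rw [hSu] at hu
  rw [hSw] at hw
  have hu1 : !![(1 : ZMod ℓ), 1; 0, 1] * !![1, -1; 0, 1] = 1 := by simp [Matrix.one_fin_two]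
  have hw1 : !![(1 : ZMod ℓ), 0; 1, 1] * !![1, 0; -1, 1] = 1 := by simp [Matrix.one_fin_two]
  have hcu : !![1, 1; 0, 1] * x * !![1, -1; 0, 1] = x := by
    rw [← hu, Matrix.mul_assoc, hu1, Matrix.mul_one]
  have hcw : !![1, 0; 1, 1] * x * !![1, 0; -1, 1] = x := by
    rw [← hw, Matrix.mul_assoc, hw1, Matrix.mul_one]
  obtain ⟨hq, hr, hps⟩ :=
    fin_two_scalar_of_commute_unipotent_conj h2 x (by rw [hcu]) (by rw [hcw])
  -- so `x` is the scalar matrix `c`, and `ψ = c`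
  obtain ⟨c, hc⟩ : ∃ c : ZMod ℓ, x = algebraMap (ZMod ℓ) (Matrix (Fin 2) (Fin 2) (ZMod ℓ)) c := by
    refine ⟨x 1 1, ?_⟩
    ext i j
    fin_cases i <;> fin_cases j <;> simp [hq, hr, hps, Matrix.algebraMap_matrix_apply]
  refine ⟨(c.val : ℤ), fun v ↦ ?_⟩
  rw [← hxψ, hc, AlgEquiv.commutes, Module.algebraMap_end_apply, natCast_zsmul,
    ← Nat.cast_smul_eq_nsmul (ZMod ℓ) c.val v, ZMod.natCast_zmod_val]

/-- **Registered stub `stub_noCMPartnerOfSurjective`** (signature verbatim): there is `L₀` such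
that for all elliptic `W, W'/ℚ` with `W'` CM, every prime `ℓ > L₀` at which the mod-`ℓ` Galois
representation of `W` is surjective, no `Γ_ℚ`-equivariant injection `W[ℓ] ↪ W'(ℚ̄)` exists.
From `cmTorsion_cartanImage_holds`: the non-scalar twisted-equivariant `φ = √D` on `W'[ℓ]`
transports along the induced equivariant isomorphism `W[ℓ] ≃ W'[ℓ]` to a non-scalar endomorphism
of `W[ℓ]` commuting with `ρ̄(σσ)` for all `σ`, i.e. (surjectivity) with all squares in
`Aut(W[ℓ])`, which forces it to be scalar (`exists_eq_zsmul_of_comm_sq`). Threshold `max L₀ 2`. -/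
theorem stub_noCMPartnerOfSurjective :
    ∃ L₀ : ℕ, ∀ (W W' : WeierstrassCurve ℚ) [W.IsElliptic] [W'.IsElliptic], W'.HasCM →
      ∀ ℓ : ℕ, ℓ.Prime → L₀ < ℓ → W.HasSurjectiveModNGaloisRep ℓ →
      (∃ ι : W.geomTorsion ℓ →+ W'.geomPoints, Function.Injective ι ∧
        ∀ (σ : Field.absoluteGaloisGroup ℚ) (P : W.geomTorsion ℓ), ι (σ • P) = σ • ι P) →
        False := by
  obtain ⟨L₀, hL⟩ := Literature.NumberTheory.EllipticCurves.cmTorsion_cartanImage_holds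
  refine ⟨max L₀ 2, ?_⟩
  intro W W' _ _ hCM ℓ hℓ hlt hsurj hι
  obtain ⟨ι, hinj, hιeq⟩ := hι
  have hL₀ : L₀ < ℓ := lt_of_le_of_lt (le_max_left _ _) hlt
  have h3 : 3 ≤ ℓ := lt_of_le_of_lt (le_max_right _ _) hlt
  obtain ⟨φ, D, χ, -, -, hns, -, htw, -⟩ := hL W' hCM ℓ hℓ hL₀
  haveI : Fact ℓ.Prime := ⟨hℓ⟩
  -- `#W[ℓ] = ℓ² = #W'[ℓ]`
  have hℓ0 : ((ℓ : ℕ) : AlgebraicClosure ℚ) ≠ 0 := by exact_mod_cast hℓ.ne_zero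
  have hcW : Nat.card (W.geomTorsion ℓ) = ℓ ^ 2 :=
    WeierstrassCurve.card_torsionPoints_eq_sq_holds W (AlgebraicClosure ℚ) hℓ0
  have hcW' : Nat.card (W'.geomTorsion ℓ) = ℓ ^ 2 :=
    WeierstrassCurve.card_torsionPoints_eq_sq_holds W' (AlgebraicClosure ℚ) hℓ0
  -- `ι` lands in `W'[ℓ]` and induces an equivariant isomorphism `e : W[ℓ] ≃+ W'[ℓ]`
  have hmem : ∀ P : W.geomTorsion ℓ, ι P ∈ W'.geomTorsion ℓ := fun P ↦
    AddSubgroup.torsionBy.nsmul_iff.2 (by rw [← map_nsmul, AddSubgroup.torsionBy.nsmul, map_zero])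
  let ι' : W.geomTorsion ℓ →+ W'.geomTorsion ℓ := ι.codRestrict (W'.geomTorsion ℓ) hmem
  have hι' : Function.Injective ι' := fun P Q h ↦ hinj (congrArg Subtype.val h)
  haveI : Finite (W'.geomTorsion ℓ) :=
    Nat.finite_of_card_ne_zero (by rw [hcW']; exact pow_ne_zero _ hℓ.ne_zero)
  have hbij : Function.Bijective ι' := hι'.bijective_of_nat_card_le (hcW'.trans hcW.symm).le
  let e : W.geomTorsion ℓ ≃+ W'.geomTorsion ℓ := AddEquiv.ofBijective ι' hbij
  have he : ∀ (σ : Field.absoluteGaloisGroup ℚ) (P : W.geomTorsion ℓ), e (σ • P) = σ • e P :=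
    fun σ P ↦ Subtype.ext (hιeq σ P)
  have he' : ∀ (σ : Field.absoluteGaloisGroup ℚ) (Q : W'.geomTorsion ℓ),
      e.symm (σ • Q) = σ • e.symm Q := by
    intro σ Q
    apply e.injective
    rw [e.apply_symm_apply, he, e.apply_symm_apply]
  -- the transport `ψ = e⁻¹ φ e` commutes with the square of every additive automorphism
  let ψ : W.geomTorsion ℓ →+ W.geomTorsion ℓ :=
    e.symm.toAddMonoidHom.comp (φ.comp e.toAddMonoidHom)
  have hψ : ∀ v, ψ v = e.symm (φ (e v)) := fun v ↦ rfl
  have hcomm : ∀ (g : W.geomTorsion ℓ ≃+ W.geomTorsion ℓ) (v : W.geomTorsion ℓ),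
      ψ (g (g v)) = g (g (ψ v)) := by
    intro g v
    obtain ⟨σ, hσ⟩ := hsurj (Multiplicative.ofAdd g)
    have hg : ∀ P, g P = σ • P := fun P ↦ by
      have h := W.galoisRepTorsion_apply ℓ σ P
      rw [hσ, toAdd_ofAdd] at h
      exact h
    have hχ : χ (σ * σ) = 1 := by rw [map_mul, Int.units_mul_self]
    simp only [hg, ← mul_smul]
    rw [hψ, hψ, he, htw, hχ, Units.val_one, one_smul, he']
  -- hence `ψ`, and with it `φ`, is an integer scalar: contradiction
  obtain ⟨c, hc⟩ :=
    exists_eq_zsmul_of_comm_sq h3 hcW (fun v ↦ AddSubgroup.torsionBy.nsmul v) ψ hcomm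
  obtain ⟨P, hP⟩ := hns c
  apply hP
  have h1 := hc (e.symm P)
  rw [hψ, e.apply_symm_apply, ← map_zsmul e.symm] at h1
  exact e.symm.injective h1

end Summit.ABC.ABC.Theorems.GluingSlices

end
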